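import Literature.NumberTheory.Transcendental.CubeChartDyadic
import Literature.NumberTheory.Transcendental.CubeMonomialGerms
import Literature.NumberTheory.Transcendental.CubeChartMonomial
import Literature.NumberTheory.Transcendental.SlabCharts
import Mathlib.Analysis.Analytic.ChangeOrigin
import HarnessLib

/-!
# Toric repair of binomial product forms along cube charts

The last, purely combinatorial step of a Jung-type cube-monomialisation (rectilinearisation) of
real-analytic functions along an atlas of the closed unit cube `K = [0,1]ⁿ` by charts of the
"analytic–semialgebraic format" (analytic at `K`, `ℚ`-semialgebraic, injective and with
`det D ≠ 0` on the open cube `O = (0,1)ⁿ`). Suppose that along every chart `Φᵢ` every function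
`Gⱼ` of a finite family is in BINOMIAL PRODUCT FORM on an open `U ⊇ K`:

  `Gⱼ ∘ Φᵢ = M₀ e₀ · ∏ₗ (M₁ e₁ + M₂ e₂)^{mₗ} · ∏ₗ ((M₃ e₃ + M₄ e₄)² + M₅ e₅)^{m'ₗ}`

with cube-monomials `M = ∏ xᵢ^{aᵢ} (1 - xᵢ)^{bᵢ}`, an analytic nowhere-zero `e₀` and analytic
POSITIVE units `e₁, …, e₅` on `U`. Then, refining the atlas first by the `2ⁿ` dyadic charts `D_c`
(`CubeChartDyadic`: every cube-monomial becomes a pure monomial times a positive unit near `K`) and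
then by the simplicial monomial charts `μ_A` of a toric principalization of the finite set of
exponents so obtained together with their doubles (`CubeChartMonomial`: monomials pull back to
monomials with exponents `Aᵀp`, which become pairwise comparable), every `Gⱼ` becomes
CUBE-MONOMIAL (`M · e`, `e` analytic and nowhere zero on an open set containing `K`) along every
chart of the refined atlas (`exists_fin_atlas_cubeMonomial_of_binomialForm`); the refined atlas has
the same format, the same images up to null sets, and pairwise disjoint open-cube images
(`CubeChartBasics.atlas_refine`). The germ algebra (`xᵖu + x^q w = xᵖ · unit` for `p ≤ q`, and
`(xᵖu)² + xʳw` likewise) is `CubeMonomialGerms`. The toric principalization itself (existence of the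
charts `μ_A`) is taken as a hypothesis, in the literal form in which the tree provides it.

No definitions are introduced; the dyadic and monomial charts are written as lambdas, or
characterised by the coordinate formula `τ v i = if c i then 1 - (∏ j, v j ^ A i j) / 2 else …`.

## References

* E. Bierstone, P. Milman, *Semianalytic and subanalytic sets*, Publ. IHÉS 67 (1988), §4.
* W. Fulton, *Introduction to Toric Varieties* (1993), §2.6.
* M. Kontsevich, D. Zagier, *Periods* (2001), §1.2.
-/

noncomputable section

open Set Filter Topology _root_.MeasureTheory
open Literature.ModelTheory.ExponentialFields (IsSemialgebraic)

namespace Literature.NumberTheory.Transcendental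

variable {n : ℕ}

/-! ### Germ transport along charts -/

/-- **Germ transport.** A property holding on a neighbourhood of `L` pulls back, along a map `σ`
continuous at the points of `K` with `σ(K) ⊆ L`, to a property holding on a neighbourhood of `K`.
[folklore] -/
theorem eventually_nhdsSet_comp {X Y : Type*} [TopologicalSpace X] [TopologicalSpace Y]
    {K : Set X} {L : Set Y} {σ : X → Y} (hσ : ∀ x ∈ K, ContinuousAt σ x) (hKL : MapsTo σ K L)
    {P : Y → Prop} (h : ∀ᶠ y in 𝓝ˢ L, P y) : ∀ᶠ x in 𝓝ˢ K, P (σ x) := by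
  rw [eventually_nhdsSet_iff_forall] at h ⊢
  exact fun x hx => (hσ x hx).tendsto.eventually (h (σ x) (hKL hx))

/-- An analytic unit on an open `U ⊇ K` (`P (e x)` on `U`, e.g. `0 < e x` or `e x ≠ 0`) pulls back
along a map `τ`, analytic at the points of `K` with `τ(K) ⊆ K`, to a germ of analytic units along
`K`. [folklore] -/
theorem eventually_nhdsSet_unit_comp {K : Set (Fin n → ℝ)} {τ : (Fin n → ℝ) → (Fin n → ℝ)}
    (hτK : MapsTo τ K K) (hτa : ∀ v ∈ K, AnalyticAt ℝ τ v) {U : Set (Fin n → ℝ)} (hU : IsOpen U)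
    (hKU : K ⊆ U) {e : (Fin n → ℝ) → ℝ} (hea : AnalyticOnNhd ℝ e U) {P : ℝ → Prop}
    (hep : ∀ x ∈ U, P (e x)) :
    ∀ᶠ v in 𝓝ˢ K, AnalyticAt ℝ (fun w => e (τ w)) v ∧ P (e (τ v)) := by
  have h1 : ∀ᶠ x in 𝓝ˢ K, AnalyticAt ℝ e x ∧ P (e x) :=
    eventually_of_mem (hU.mem_nhdsSet.2 hKU) fun x hx => ⟨hea x hx, hep x hx⟩
  have h2 : ∀ᶠ v in 𝓝ˢ K, AnalyticAt ℝ τ v :=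
    eventually_nhdsSet_iff_forall.2 fun v hv => (hτa v hv).eventually_analyticAt
  filter_upwards [h2, eventually_nhdsSet_comp (fun v hv => (hτa v hv).continuousAt) hτK h1]
    with v hv hv'
  exact ⟨hv'.1.fun_comp hv, hv'.2⟩

/-! ### Binomial product forms along a chart with monomial pull-backs -/

/-- **Binomial product forms become cube-monomial along a repairing chart.** Let `K` lie in the
closed positive orthant and let `τ : ℝⁿ → ℝⁿ` be analytic at `K` with `τ(K) ⊆ K`, such that every
cube-monomial `∏ (τ v)ᵢ^{aᵢ} (1 - (τ v)ᵢ)^{bᵢ}` is a positive monomial germ along `K` with exponent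
`π a b`. If `F` is in binomial product form
`M₀e₀ · ∏ₗ (M₁e₁ + M₂e₂)^{mₗ} · ∏ₗ ((M₃e₃ + M₄e₄)² + M₅e₅)^{m'ₗ}` on an open `U ⊇ K` (units
`e₀ ≠ 0`, `e₁, …, e₅ > 0` analytic on `U`) and the exponents `π` of the two terms of every
binomial, resp. of `M₃, M₄` and of `2M₃, M₅` and `2M₄, M₅` in every trinomial, are componentwise
comparable, then `F ∘ τ = (∏ xᵢ^{aᵢ} (1 - xᵢ)^{bᵢ}) · e` on an open set containing `K`, with `e`
analytic and nowhere zero there. [folklore] -/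
theorem exists_open_cubeMonomial_comp_of_binomialForm {K : Set (Fin n → ℝ)}
    (hK : ∀ x ∈ K, ∀ i, 0 ≤ x i) {τ : (Fin n → ℝ) → (Fin n → ℝ)} (hτK : MapsTo τ K K)
    (hτa : ∀ v ∈ K, AnalyticAt ℝ τ v) {π : (Fin n → ℕ) → (Fin n → ℕ) → Fin n → ℕ}
    (hπ : ∀ a b : Fin n → ℕ, ∃ u : (Fin n → ℝ) → ℝ, ∀ᶠ v in 𝓝ˢ K, AnalyticAt ℝ u v ∧ 0 < u v ∧
      (∏ i, τ v i ^ a i * (1 - τ v i) ^ b i) = (∏ i, v i ^ π a b i) * u v)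
    {F : (Fin n → ℝ) → ℝ} {U : Set (Fin n → ℝ)} (hU : IsOpen U) (hKU : K ⊆ U)
    {a₀ b₀ : Fin n → ℕ} {e₀ : (Fin n → ℝ) → ℝ} {L₁ L₂ : ℕ} {m₁ : Fin L₁ → ℕ}
    {a₁ b₁ a₂ b₂ : Fin L₁ → Fin n → ℕ} {e₁ e₂ : Fin L₁ → (Fin n → ℝ) → ℝ} {m₂ : Fin L₂ → ℕ}
    {a₃ b₃ a₄ b₄ a₅ b₅ : Fin L₂ → Fin n → ℕ} {e₃ e₄ e₅ : Fin L₂ → (Fin n → ℝ) → ℝ}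
    (he₀ : AnalyticOnNhd ℝ e₀ U) (he₀' : ∀ x ∈ U, e₀ x ≠ 0)
    (he₁₂ : ∀ l, AnalyticOnNhd ℝ (e₁ l) U ∧ AnalyticOnNhd ℝ (e₂ l) U ∧
      ∀ x ∈ U, 0 < e₁ l x ∧ 0 < e₂ l x)
    (he₃₄₅ : ∀ l, AnalyticOnNhd ℝ (e₃ l) U ∧ AnalyticOnNhd ℝ (e₄ l) U ∧
      AnalyticOnNhd ℝ (e₅ l) U ∧ ∀ x ∈ U, 0 < e₃ l x ∧ 0 < e₄ l x ∧ 0 < e₅ l x)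
    (hF : ∀ x ∈ U, F x = (∏ i, x i ^ a₀ i * (1 - x i) ^ b₀ i) * e₀ x *
      (∏ l, ((∏ i, x i ^ a₁ l i * (1 - x i) ^ b₁ l i) * e₁ l x +
        (∏ i, x i ^ a₂ l i * (1 - x i) ^ b₂ l i) * e₂ l x) ^ m₁ l) *
      ∏ l, (((∏ i, x i ^ a₃ l i * (1 - x i) ^ b₃ l i) * e₃ l x +
        (∏ i, x i ^ a₄ l i * (1 - x i) ^ b₄ l i) * e₄ l x) ^ 2 +
        (∏ i, x i ^ a₅ l i * (1 - x i) ^ b₅ l i) * e₅ l x) ^ m₂ l)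
    (h₁₂ : ∀ l, π (a₁ l) (b₁ l) ≤ π (a₂ l) (b₂ l) ∨ π (a₂ l) (b₂ l) ≤ π (a₁ l) (b₁ l))
    (h₃₄ : ∀ l, π (a₃ l) (b₃ l) ≤ π (a₄ l) (b₄ l) ∨ π (a₄ l) (b₄ l) ≤ π (a₃ l) (b₃ l))
    (h₃₅ : ∀ l, 2 • π (a₃ l) (b₃ l) ≤ π (a₅ l) (b₅ l) ∨ π (a₅ l) (b₅ l) ≤ 2 • π (a₃ l) (b₃ l))
    (h₄₅ : ∀ l, 2 • π (a₄ l) (b₄ l) ≤ π (a₅ l) (b₅ l) ∨ π (a₅ l) (b₅ l) ≤ 2 • π (a₄ l) (b₄ l)) :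
    ∃ U' : Set (Fin n → ℝ), IsOpen U' ∧ K ⊆ U' ∧ ∃ (a b : Fin n → ℕ) (e : (Fin n → ℝ) → ℝ),
      AnalyticOnNhd ℝ e U' ∧ (∀ x ∈ U', e x ≠ 0) ∧
        ∀ x ∈ U', F (τ x) = (∏ i, x i ^ a i * (1 - x i) ^ b i) * e x := by
  -- each pulled-back factor `M(τ v) · e(τ v)` is a positive monomial germ with exponent `π a b`
  have hfac : ∀ {a b : Fin n → ℕ} {e : (Fin n → ℝ) → ℝ}, AnalyticOnNhd ℝ e U →
      (∀ x ∈ U, 0 < e x) → ∃ u : (Fin n → ℝ) → ℝ, ∀ᶠ v in 𝓝ˢ K, AnalyticAt ℝ u v ∧ 0 < u v ∧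
        (∏ i, τ v i ^ a i * (1 - τ v i) ^ b i) * e (τ v) = (∏ i, v i ^ π a b i) * u v :=
    fun hea hep => exists_posMonomialGerm_mul_unit (hπ _ _)
      (eventually_nhdsSet_unit_comp (P := fun t : ℝ => 0 < t) hτK hτa hU hKU hea hep)
  -- binomial factors (comparable exponents)
  have hbin : ∀ l, ∃ (p : Fin n → ℕ) (u : (Fin n → ℝ) → ℝ), ∀ᶠ v in 𝓝ˢ K,
      AnalyticAt ℝ u v ∧ 0 < u v ∧
        ((∏ i, τ v i ^ a₁ l i * (1 - τ v i) ^ b₁ l i) * e₁ l (τ v) +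
          (∏ i, τ v i ^ a₂ l i * (1 - τ v i) ^ b₂ l i) * e₂ l (τ v)) ^ m₁ l =
        (∏ i, v i ^ p i) * u v := fun l => by
    obtain ⟨h1a, h2a, hp⟩ := he₁₂ l
    obtain ⟨r, -, hr⟩ := exists_posMonomialGerm_add hK (h₁₂ l)
      (hfac h1a fun x hx => (hp x hx).1) (hfac h2a fun x hx => (hp x hx).2)
    exact ⟨_, exists_posMonomialGerm_pow hr (m₁ l)⟩
  -- trinomial factors (comparable exponents, including the doubles)
  have htri : ∀ l, ∃ (p : Fin n → ℕ) (u : (Fin n → ℝ) → ℝ), ∀ᶠ v in 𝓝ˢ K,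
      AnalyticAt ℝ u v ∧ 0 < u v ∧
        (((∏ i, τ v i ^ a₃ l i * (1 - τ v i) ^ b₃ l i) * e₃ l (τ v) +
          (∏ i, τ v i ^ a₄ l i * (1 - τ v i) ^ b₄ l i) * e₄ l (τ v)) ^ 2 +
          (∏ i, τ v i ^ a₅ l i * (1 - τ v i) ^ b₅ l i) * e₅ l (τ v)) ^ m₂ l =
        (∏ i, v i ^ p i) * u v := fun l => by
    obtain ⟨h3a, h4a, h5a, hp⟩ := he₃₄₅ l
    obtain ⟨r, hr, hsum⟩ := exists_posMonomialGerm_add hK (h₃₄ l)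
      (hfac h3a fun x hx => (hp x hx).1) (hfac h4a fun x hx => (hp x hx).2.1)
    have hr5 : 2 • r ≤ π (a₅ l) (b₅ l) ∨ π (a₅ l) (b₅ l) ≤ 2 • r := by
      rcases hr with rfl | rfl
      exacts [h₃₅ l, h₄₅ l]
    obtain ⟨s, hs⟩ :=
      exists_posMonomialGerm_sq_add hK hr5 hsum (hfac h5a fun x hx => (hp x hx).2.2)
    exact ⟨_, exists_posMonomialGerm_pow hs (m₂ l)⟩
  obtain ⟨p₁, hp₁⟩ := exists_posMonomialGerm_prod Finset.univ _ fun l _ => hbin l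
  obtain ⟨p₂, hp₂⟩ := exists_posMonomialGerm_prod Finset.univ _ fun l _ => htri l
  -- the front factor is a nowhere-zero monomial germ
  have h0 : ∃ u : (Fin n → ℝ) → ℝ, ∀ᶠ v in 𝓝ˢ K, AnalyticAt ℝ u v ∧ u v ≠ 0 ∧
      (∏ i, τ v i ^ a₀ i * (1 - τ v i) ^ b₀ i) * e₀ (τ v) = (∏ i, v i ^ π a₀ b₀ i) * u v :=
    exists_monomialGerm_mul_unit (hπ a₀ b₀)
      (eventually_nhdsSet_unit_comp (P := fun t : ℝ => t ≠ 0) hτK hτa hU hKU he₀ he₀')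
  have hprod := exists_monomialGerm_mul
    (exists_monomialGerm_mul h0 (exists_monomialGerm_of_pos hp₁)) (exists_monomialGerm_of_pos hp₂)
  -- the product formula, pulled back along `τ`, holds near `K`
  have hFτ := eventually_nhdsSet_comp (fun v hv => (hτa v hv).continuousAt) hτK
    (eventually_of_mem (hU.mem_nhdsSet.2 hKU) hF)
  exact exists_open_cubeMonomial_of_monomialGerm
    (exists_monomialGerm_congr (P := fun t : ℝ => t ≠ 0) (hFτ.mono fun v hv => hv.symm) hprod)

/-! ### The repairing charts `D_c ∘ μ_A` -/

/-- **Cube-monomials along `D_c ∘ μ_A`.** If `τ v i = 1 - (μ_A v)ᵢ/2` (`cᵢ`) resp. `(μ_A v)ᵢ/2`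
(`¬cᵢ`), `(μ_A v)ᵢ = ∏ⱼ vⱼ^{A i j}`, then `∏ (τ v)ᵢ^{aᵢ}(1 - (τ v)ᵢ)^{bᵢ}` is a positive monomial
germ along the closed cube with exponent `Aᵀp`, `pᵢ = bᵢ` if `cᵢ` else `aᵢ` (dyadic
localisation followed by the monomial pull-back). [folklore] -/
theorem exists_posMonomialGerm_cubeMonomial_dyadic_monomialMap (c : Fin n → Bool)
    (A : Matrix (Fin n) (Fin n) ℕ) {τ : (Fin n → ℝ) → (Fin n → ℝ)}
    (hτ : ∀ v i, τ v i = if c i then 1 - (∏ j, v j ^ A i j) / 2 else (∏ j, v j ^ A i j) / 2)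
    (a b : Fin n → ℕ) {p : Fin n → ℕ} (hp : ∀ i, p i = if c i then b i else a i) :
    ∃ u : (Fin n → ℝ) → ℝ, ∀ᶠ v in 𝓝ˢ (Set.pi Set.univ fun _ : Fin n => Set.Icc (0 : ℝ) 1),
      AnalyticAt ℝ u v ∧ 0 < u v ∧
        (∏ i, τ v i ^ a i * (1 - τ v i) ^ b i) = (∏ j, v j ^ (∑ i, A i j * p i)) * u v := by
  refine ⟨fun v => ∏ i, (if c i then (1 / 2 : ℝ) ^ b i * (1 - (∏ j, v j ^ A i j) / 2) ^ a i
      else (1 / 2 : ℝ) ^ a i * (1 - (∏ j, v j ^ A i j) / 2) ^ b i), ?_⟩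
  have hW := eventually_nhdsSet_comp (fun v _ => (continuous_monomialMap A).continuousAt)
    (monomialMap_mapsTo_pi_Icc A) (eventually_nhdsSet_dyadicUnit c a b)
  filter_upwards [hW] with v hv
  have hua := (analyticAt_dyadicUnit c a b _).fun_comp (analyticAt_monomialMap A v)
  refine ⟨hua, hv.2, ?_⟩
  have h1 : (∏ i, τ v i ^ a i * (1 - τ v i) ^ b i) = (∏ i, (∏ j, v j ^ A i j) ^ p i) *
      ∏ i, (if c i then (1 / 2 : ℝ) ^ b i * (1 - (∏ j, v j ^ A i j) / 2) ^ a i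
        else (1 / 2 : ℝ) ^ a i * (1 - (∏ j, v j ^ A i j) / 2) ^ b i) := by
    rw [cubeMonomial_dyadic c a b (hτ v)]
    simp only [← hp]
  have h2 : (∏ i, (∏ j, v j ^ A i j) ^ p i) = ∏ j, v j ^ (∑ i, A i j * p i) :=
    prod_pow_monomialMap A p fun i => rfl
  rw [h1, h2]

/-- Comparability of `Aᵀ(2p)` with `Aᵀq` is comparability of `2 • Aᵀp` with `Aᵀq`. [folklore] -/
theorem two_nsmul_transpose_comparable (A : Matrix (Fin n) (Fin n) ℕ) {p q : Fin n → ℕ}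
    (h : (∀ j, ∑ i, A i j * (2 • p) i ≤ ∑ i, A i j * q i) ∨
      (∀ j, ∑ i, A i j * q i ≤ ∑ i, A i j * (2 • p) i)) :
    (2 • fun j => ∑ i, A i j * p i) ≤ (fun j => ∑ i, A i j * q i) ∨
      (fun j => ∑ i, A i j * q i) ≤ 2 • fun j => ∑ i, A i j * p i := by
  simp only [sum_mul_two_nsmul] at h
  rcases h with h | h
  · exact Or.inl fun j => by simpa only [Pi.smul_apply, smul_eq_mul] using h j
  · exact Or.inr fun j => by simpa only [Pi.smul_apply, smul_eq_mul] using h j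

/-- **The finite comparability set of a binomial product form.** For `F` in binomial product form
near the closed cube and a corner pattern `c`, there is a finite set `T` of exponent vectors (the
dyadic exponents of all cube-monomials of the form, and the doubles of those of `M₃, M₄`) such that
for every `A ∈ ℕ^{n×n}` along which the pulled-back exponents `Aᵀa`, `a ∈ T`, are pairwise
comparable, `F ∘ D_c ∘ μ_A` is cube-monomial near the closed cube. [folklore] -/
theorem exists_finset_cubeMonomial_comp_of_binomialForm (c : Fin n → Bool) {F : (Fin n → ℝ) → ℝ}
    (hF : ∃ U : Set (Fin n → ℝ), IsOpen U ∧ Set.pi Set.univ (fun _ : Fin n => Set.Icc (0:ℝ) 1) ⊆ U ∧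
      ∃ (a₀ b₀ : Fin n → ℕ) (e₀ : (Fin n → ℝ) → ℝ) (L₁ L₂ : ℕ) (m₁ : Fin L₁ → ℕ)
        (a₁ b₁ a₂ b₂ : Fin L₁ → Fin n → ℕ) (e₁ e₂ : Fin L₁ → (Fin n → ℝ) → ℝ) (m₂ : Fin L₂ → ℕ)
        (a₃ b₃ a₄ b₄ a₅ b₅ : Fin L₂ → Fin n → ℕ) (e₃ e₄ e₅ : Fin L₂ → (Fin n → ℝ) → ℝ),
        AnalyticOnNhd ℝ e₀ U ∧ (∀ x ∈ U, e₀ x ≠ 0) ∧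
        (∀ l, AnalyticOnNhd ℝ (e₁ l) U ∧ AnalyticOnNhd ℝ (e₂ l) U ∧
          ∀ x ∈ U, 0 < e₁ l x ∧ 0 < e₂ l x) ∧
        (∀ l, AnalyticOnNhd ℝ (e₃ l) U ∧ AnalyticOnNhd ℝ (e₄ l) U ∧ AnalyticOnNhd ℝ (e₅ l) U ∧
          ∀ x ∈ U, 0 < e₃ l x ∧ 0 < e₄ l x ∧ 0 < e₅ l x) ∧
        ∀ x ∈ U, F x = (∏ i, x i ^ a₀ i * (1 - x i) ^ b₀ i) * e₀ x *
          (∏ l, ((∏ i, x i ^ a₁ l i * (1 - x i) ^ b₁ l i) * e₁ l x +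
            (∏ i, x i ^ a₂ l i * (1 - x i) ^ b₂ l i) * e₂ l x) ^ m₁ l) *
          ∏ l, (((∏ i, x i ^ a₃ l i * (1 - x i) ^ b₃ l i) * e₃ l x +
            (∏ i, x i ^ a₄ l i * (1 - x i) ^ b₄ l i) * e₄ l x) ^ 2 +
            (∏ i, x i ^ a₅ l i * (1 - x i) ^ b₅ l i) * e₅ l x) ^ m₂ l) :
    ∃ T : Finset (Fin n → ℕ), ∀ A : Matrix (Fin n) (Fin n) ℕ,
      (∀ a ∈ T, ∀ b ∈ T, (∀ j, ∑ i, A i j * a i ≤ ∑ i, A i j * b i) ∨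
        (∀ j, ∑ i, A i j * b i ≤ ∑ i, A i j * a i)) →
      ∀ τ : (Fin n → ℝ) → (Fin n → ℝ),
        (∀ v i, τ v i = if c i then 1 - (∏ j, v j ^ A i j) / 2 else (∏ j, v j ^ A i j) / 2) →
        ∃ U : Set (Fin n → ℝ), IsOpen U ∧ Set.pi Set.univ (fun _ : Fin n => Set.Icc (0:ℝ) 1) ⊆ U ∧
          ∃ (a b : Fin n → ℕ) (e : (Fin n → ℝ) → ℝ), AnalyticOnNhd ℝ e U ∧ (∀ x ∈ U, e x ≠ 0) ∧
            ∀ x ∈ U, F (τ x) = (∏ i, x i ^ a i * (1 - x i) ^ b i) * e x := by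
  classical
  obtain ⟨U, hU, hKU, a₀, b₀, e₀, L₁, L₂, m₁, a₁, b₁, a₂, b₂, e₁, e₂, m₂, a₃, b₃, a₄, b₄, a₅, b₅,
    e₃, e₄, e₅, he₀, he₀', he₁₂, he₃₄₅, hF⟩ := hF
  -- the dyadic exponents `dx a b = (cᵢ ? bᵢ : aᵢ)ᵢ`
  obtain ⟨dx, hdx⟩ : ∃ dx : (Fin n → ℕ) → (Fin n → ℕ) → Fin n → ℕ,
      ∀ a b i, dx a b i = if c i then b i else a i := ⟨_, fun _ _ _ => rfl⟩
  refine ⟨(Finset.univ.biUnion fun l => {dx (a₁ l) (b₁ l), dx (a₂ l) (b₂ l)}) ∪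
      Finset.univ.biUnion fun l => {dx (a₃ l) (b₃ l), dx (a₄ l) (b₄ l), dx (a₅ l) (b₅ l),
        2 • dx (a₃ l) (b₃ l), 2 • dx (a₄ l) (b₄ l)}, fun A hA τ hτ => ?_⟩
  have mem₁ : ∀ l, ∀ x ∈ ({dx (a₁ l) (b₁ l), dx (a₂ l) (b₂ l)} : Finset (Fin n → ℕ)),
      x ∈ (Finset.univ.biUnion fun l => {dx (a₁ l) (b₁ l), dx (a₂ l) (b₂ l)}) ∪
        Finset.univ.biUnion fun l => {dx (a₃ l) (b₃ l), dx (a₄ l) (b₄ l), dx (a₅ l) (b₅ l),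
          2 • dx (a₃ l) (b₃ l), 2 • dx (a₄ l) (b₄ l)} := fun l x hx =>
    Finset.mem_union_left _ (Finset.mem_biUnion.2 ⟨l, Finset.mem_univ _, hx⟩)
  have mem₂ : ∀ l, ∀ x ∈ ({dx (a₃ l) (b₃ l), dx (a₄ l) (b₄ l), dx (a₅ l) (b₅ l),
      2 • dx (a₃ l) (b₃ l), 2 • dx (a₄ l) (b₄ l)} : Finset (Fin n → ℕ)),
      x ∈ (Finset.univ.biUnion fun l => {dx (a₁ l) (b₁ l), dx (a₂ l) (b₂ l)}) ∪
        Finset.univ.biUnion fun l => {dx (a₃ l) (b₃ l), dx (a₄ l) (b₄ l), dx (a₅ l) (b₅ l),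
          2 • dx (a₃ l) (b₃ l), 2 • dx (a₄ l) (b₄ l)} := fun l x hx =>
    Finset.mem_union_right _ (Finset.mem_biUnion.2 ⟨l, Finset.mem_univ _, hx⟩)
  have hK : ∀ x ∈ Set.pi Set.univ (fun _ : Fin n => Set.Icc (0:ℝ) 1), ∀ i, 0 ≤ x i :=
    fun x hx i => (hx i (Set.mem_univ _)).1
  obtain rfl : τ = fun v =>
      (fun (y : Fin n → ℝ) (i : Fin n) => if c i then 1 - y i / 2 else y i / 2)
        ((fun (v : Fin n → ℝ) (i : Fin n) => ∏ j, v j ^ A i j) v) :=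
    funext fun v => funext fun i => hτ v i
  have hτK : MapsTo (fun v =>
      (fun (y : Fin n → ℝ) (i : Fin n) => if c i then 1 - y i / 2 else y i / 2)
        ((fun (v : Fin n → ℝ) (i : Fin n) => ∏ j, v j ^ A i j) v))
      (Set.pi Set.univ (fun _ : Fin n => Set.Icc (0:ℝ) 1))
      (Set.pi Set.univ (fun _ : Fin n => Set.Icc (0:ℝ) 1)) :=
    (dyadic_mapsTo_pi_Icc c).comp (monomialMap_mapsTo_pi_Icc A)
  have hτa : ∀ v ∈ Set.pi Set.univ (fun _ : Fin n => Set.Icc (0:ℝ) 1), AnalyticAt ℝ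
      (fun v => (fun (y : Fin n → ℝ) (i : Fin n) => if c i then 1 - y i / 2 else y i / 2)
        ((fun (v : Fin n → ℝ) (i : Fin n) => ∏ j, v j ^ A i j) v)) v :=
    fun v _ => (analyticAt_dyadic c _).fun_comp (analyticAt_monomialMap A v)
  exact exists_open_cubeMonomial_comp_of_binomialForm hK hτK hτa
    (π := fun a b j => ∑ i, A i j * dx a b i)
    (fun a b => exists_posMonomialGerm_cubeMonomial_dyadic_monomialMap c A hτ a b (hdx a b))
    hU hKU he₀ he₀' he₁₂ he₃₄₅ hF
    (fun l => hA (dx (a₁ l) (b₁ l)) (mem₁ l _ (by simp)) (dx (a₂ l) (b₂ l)) (mem₁ l _ (by simp)))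
    (fun l => hA (dx (a₃ l) (b₃ l)) (mem₂ l _ (by simp)) (dx (a₄ l) (b₄ l)) (mem₂ l _ (by simp)))
    (fun l => two_nsmul_transpose_comparable A
      (hA (2 • dx (a₃ l) (b₃ l)) (mem₂ l _ (by simp)) (dx (a₅ l) (b₅ l)) (mem₂ l _ (by simp))))
    (fun l => two_nsmul_transpose_comparable A
      (hA (2 • dx (a₄ l) (b₄ l)) (mem₂ l _ (by simp)) (dx (a₅ l) (b₅ l)) (mem₂ l _ (by simp))))

/-! ### Refining an atlas in binomial product form to a cube-monomial atlas -/

/-- **Toric repair of an atlas in binomial product form.** Let `Φᵢ` (`i : ι`, finite) be charts of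
the analytic–semialgebraic format with pairwise disjoint open-cube images in `B` exhausting `B` up
to a null set, along which every `Gⱼ` (`j : J`, finite) is in binomial product form near the closed
cube. Assume the toric principalization of finite exponent sets by simplicial monomial charts of the
cube (hypothesis `hT`, Fulton 1993 §2.6). Then there are finitely many charts `Ψₖ` of the same
format, with pairwise disjoint open-cube images in `B` exhausting `B` up to a null set, along
which every `Gⱼ` is cube-monomial near the closed cube: the composites `Φᵢ ∘ D_c ∘ μ_A` over all
corner patterns `c` and all charts `μ_A` of the principalization of the dyadic exponents (and their
doubles) of all the binomial forms. [folklore] -/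
theorem exists_fin_atlas_cubeMonomial_of_binomialForm {ι J : Type*} [Fintype ι] [Fintype J]
    (hT : ∀ S : Finset (Fin n → ℕ), ∃ (M : ℕ) (A : Fin M → Matrix (Fin n) (Fin n) ℕ),
      (∀ c, ((A c).map (fun t : ℕ => (t : ℝ))).det ≠ 0) ∧
      Pairwise (fun c c' => Disjoint
        ((fun v : Fin n → ℝ => fun i => ∏ j, v j ^ A c i j) ''
          Set.pi Set.univ (fun _ : Fin n => Set.Ioo (0:ℝ) 1))
        ((fun v : Fin n → ℝ => fun i => ∏ j, v j ^ A c' i j) ''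
          Set.pi Set.univ (fun _ : Fin n => Set.Ioo (0:ℝ) 1))) ∧
      volume (Set.pi Set.univ (fun _ : Fin n => Set.Ioo (0:ℝ) 1) \
        ⋃ c, (fun v : Fin n → ℝ => fun i => ∏ j, v j ^ A c i j) ''
          Set.pi Set.univ (fun _ : Fin n => Set.Ioo (0:ℝ) 1)) = 0 ∧
      ∀ c, ∀ a ∈ S, ∀ b ∈ S, (∀ j, ∑ i, A c i j * a i ≤ ∑ i, A c i j * b i) ∨
        (∀ j, ∑ i, A c i j * b i ≤ ∑ i, A c i j * a i))
    {B : Set (Fin n → ℝ)} {Φ : ι → (Fin n → ℝ) → (Fin n → ℝ)} (G : J → (Fin n → ℝ) → ℝ)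
    (hΦ : ∀ i, AnalyticOnNhd ℝ (Φ i) (Set.pi Set.univ (fun _ : Fin n => Set.Icc (0:ℝ) 1)) ∧
      IsSemialgebraicMapOn ℚ (Set.pi Set.univ (fun _ : Fin n => Set.Ioo (0:ℝ) 1)) (Φ i) ∧
      InjOn (Φ i) (Set.pi Set.univ (fun _ : Fin n => Set.Ioo (0:ℝ) 1)) ∧
      ∀ x ∈ Set.pi Set.univ (fun _ : Fin n => Set.Ioo (0:ℝ) 1), (fderiv ℝ (Φ i) x).det ≠ 0)
    (hΦB : ∀ i, Φ i '' Set.pi Set.univ (fun _ : Fin n => Set.Ioo (0:ℝ) 1) ⊆ B)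
    (hΦdisj : Pairwise fun i i' =>
      Disjoint (Φ i '' Set.pi Set.univ (fun _ : Fin n => Set.Ioo (0:ℝ) 1))
        (Φ i' '' Set.pi Set.univ (fun _ : Fin n => Set.Ioo (0:ℝ) 1)))
    (hΦnull : volume (B \ ⋃ i, Φ i '' Set.pi Set.univ (fun _ : Fin n => Set.Ioo (0:ℝ) 1)) = 0)
    (hG : ∀ i j, ∃ U : Set (Fin n → ℝ), IsOpen U ∧
      Set.pi Set.univ (fun _ : Fin n => Set.Icc (0:ℝ) 1) ⊆ U ∧
      ∃ (a₀ b₀ : Fin n → ℕ) (e₀ : (Fin n → ℝ) → ℝ) (L₁ L₂ : ℕ) (m₁ : Fin L₁ → ℕ)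
        (a₁ b₁ a₂ b₂ : Fin L₁ → Fin n → ℕ) (e₁ e₂ : Fin L₁ → (Fin n → ℝ) → ℝ) (m₂ : Fin L₂ → ℕ)
        (a₃ b₃ a₄ b₄ a₅ b₅ : Fin L₂ → Fin n → ℕ) (e₃ e₄ e₅ : Fin L₂ → (Fin n → ℝ) → ℝ),
        AnalyticOnNhd ℝ e₀ U ∧ (∀ x ∈ U, e₀ x ≠ 0) ∧
        (∀ l, AnalyticOnNhd ℝ (e₁ l) U ∧ AnalyticOnNhd ℝ (e₂ l) U ∧
          ∀ x ∈ U, 0 < e₁ l x ∧ 0 < e₂ l x) ∧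
        (∀ l, AnalyticOnNhd ℝ (e₃ l) U ∧ AnalyticOnNhd ℝ (e₄ l) U ∧ AnalyticOnNhd ℝ (e₅ l) U ∧
          ∀ x ∈ U, 0 < e₃ l x ∧ 0 < e₄ l x ∧ 0 < e₅ l x) ∧
        ∀ x ∈ U, G j (Φ i x) = (∏ i, x i ^ a₀ i * (1 - x i) ^ b₀ i) * e₀ x *
          (∏ l, ((∏ i, x i ^ a₁ l i * (1 - x i) ^ b₁ l i) * e₁ l x +
            (∏ i, x i ^ a₂ l i * (1 - x i) ^ b₂ l i) * e₂ l x) ^ m₁ l) *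
          ∏ l, (((∏ i, x i ^ a₃ l i * (1 - x i) ^ b₃ l i) * e₃ l x +
            (∏ i, x i ^ a₄ l i * (1 - x i) ^ b₄ l i) * e₄ l x) ^ 2 +
            (∏ i, x i ^ a₅ l i * (1 - x i) ^ b₅ l i) * e₅ l x) ^ m₂ l) :
    ∃ (N : ℕ) (Ψ : Fin N → (Fin n → ℝ) → (Fin n → ℝ)),
      (∀ i, AnalyticOnNhd ℝ (Ψ i) (Set.pi Set.univ (fun _ : Fin n => Set.Icc (0:ℝ) 1)) ∧
        IsSemialgebraicMapOn ℚ (Set.pi Set.univ (fun _ : Fin n => Set.Ioo (0:ℝ) 1)) (Ψ i) ∧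
        InjOn (Ψ i) (Set.pi Set.univ (fun _ : Fin n => Set.Ioo (0:ℝ) 1)) ∧
        ∀ x ∈ Set.pi Set.univ (fun _ : Fin n => Set.Ioo (0:ℝ) 1), (fderiv ℝ (Ψ i) x).det ≠ 0) ∧
      (∀ i, Ψ i '' Set.pi Set.univ (fun _ : Fin n => Set.Ioo (0:ℝ) 1) ⊆ B) ∧
      Pairwise (fun i i' => Disjoint (Ψ i '' Set.pi Set.univ (fun _ : Fin n => Set.Ioo (0:ℝ) 1))
        (Ψ i' '' Set.pi Set.univ (fun _ : Fin n => Set.Ioo (0:ℝ) 1))) ∧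
      volume (B \ ⋃ i, Ψ i '' Set.pi Set.univ (fun _ : Fin n => Set.Ioo (0:ℝ) 1)) = 0 ∧
      ∀ i j, ∃ U : Set (Fin n → ℝ), IsOpen U ∧
        Set.pi Set.univ (fun _ : Fin n => Set.Icc (0:ℝ) 1) ⊆ U ∧
        ∃ (a b : Fin n → ℕ) (e : (Fin n → ℝ) → ℝ), AnalyticOnNhd ℝ e U ∧ (∀ x ∈ U, e x ≠ 0) ∧
          ∀ x ∈ U, G j (Ψ i x) = (∏ i, x i ^ a i * (1 - x i) ^ b i) * e x := by
  classical
  -- the finite comparability sets of all the binomial forms, and their principalization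
  choose T hT' using fun (i : ι) (c : Fin n → Bool) (j : J) =>
    exists_finset_cubeMonomial_comp_of_binomialForm c (F := fun x => G j (Φ i x)) (hG i j)
  obtain ⟨M, A, hAdet, hAdisj, hAnull, hAcomp⟩ :=
    hT (Finset.univ.biUnion fun t : ι × (Fin n → Bool) × J => T t.1 t.2.1 t.2.2)
  have hOK := pi_Ioo_subset_pi_Icc n
  -- refinement by the dyadic charts
  obtain ⟨h1f, h1B, h1d, h1n⟩ := atlas_refine
    (σ := fun (c : Fin n → Bool) (y : Fin n → ℝ) (i : Fin n) =>
      if c i then 1 - y i / 2 else y i / 2)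
    hOK (fun i => (hΦ i).1) (fun i => (hΦ i).2.1) (fun i => (hΦ i).2.2.1) (fun i => (hΦ i).2.2.2)
    hΦB hΦdisj hΦnull (fun c x _ => analyticAt_dyadic c x)
    (fun c => isSemialgebraicMapOn_dyadic c (isSemialgebraic_pi_Ioo_unit n))
    (fun c => (injective_dyadicChart c).injOn) (fun c x _ => det_fderiv_dyadic_ne_zero c x)
    dyadic_mapsTo_pi_Icc dyadic_mapsTo_pi_Ioo pairwise_disjoint_image_dyadic
    volume_pi_Ioo_diff_iUnion_image_dyadic
  -- refinement by the monomial charts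
  obtain ⟨h2f, h2B, h2d, h2n⟩ := atlas_refine
    (σ := fun (m : Fin M) (v : Fin n → ℝ) (i : Fin n) => ∏ j, v j ^ A m i j)
    hOK (fun p => (h1f p).1) (fun p => (h1f p).2.1) (fun p => (h1f p).2.2.1)
    (fun p => (h1f p).2.2.2) h1B h1d h1n (fun m x _ => analyticAt_monomialMap (A m) x)
    (fun m => isSemialgebraicMapOn_monomialMap (A m) (isSemialgebraic_pi_Ioo_unit n))
    (fun m => injOn_monomialMap_pi_Ioo (hAdet m))
    (fun m x hx => det_fderiv_monomialMap_ne_zero_of_mem_pi_Ioo (hAdet m) hx)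
    (fun m => monomialMap_mapsTo_pi_Icc (A m)) (fun m => monomialMap_mapsTo_pi_Ioo (hAdet m))
    hAdisj hAnull
  -- the cube-monomial clause along the composites
  have hmono : ∀ (q : (ι × (Fin n → Bool)) × Fin M) (j : J), ∃ U : Set (Fin n → ℝ), IsOpen U ∧
      Set.pi Set.univ (fun _ : Fin n => Set.Icc (0:ℝ) 1) ⊆ U ∧
      ∃ (a b : Fin n → ℕ) (e : (Fin n → ℝ) → ℝ), AnalyticOnNhd ℝ e U ∧ (∀ x ∈ U, e x ≠ 0) ∧
        ∀ x ∈ U, G j (Φ q.1.1 (fun i => if q.1.2 i then 1 - (∏ j, x j ^ A q.2 i j) / 2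
          else (∏ j, x j ^ A q.2 i j) / 2)) = (∏ i, x i ^ a i * (1 - x i) ^ b i) * e x :=
    fun q j => hT' q.1.1 q.1.2 j (A q.2)
      (fun a ha b hb =>
        hAcomp q.2 a (Finset.mem_biUnion.2 ⟨(q.1.1, q.1.2, j), Finset.mem_univ _, ha⟩)
          b (Finset.mem_biUnion.2 ⟨(q.1.1, q.1.2, j), Finset.mem_univ _, hb⟩))
      (fun x i => if q.1.2 i then 1 - (∏ j, x j ^ A q.2 i j) / 2 else (∏ j, x j ^ A q.2 i j) / 2)
      fun _ _ => rfl
  -- re-indexing by `Fin N`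
  obtain ⟨N, Ψ, hP, hdisj, hnull⟩ := exists_fin_reindex_atlas volume
    (fun Ψ : (Fin n → ℝ) → (Fin n → ℝ) =>
      (AnalyticOnNhd ℝ Ψ (Set.pi Set.univ (fun _ : Fin n => Set.Icc (0:ℝ) 1)) ∧
        IsSemialgebraicMapOn ℚ (Set.pi Set.univ (fun _ : Fin n => Set.Ioo (0:ℝ) 1)) Ψ ∧
        InjOn Ψ (Set.pi Set.univ (fun _ : Fin n => Set.Ioo (0:ℝ) 1)) ∧
        ∀ x ∈ Set.pi Set.univ (fun _ : Fin n => Set.Ioo (0:ℝ) 1), (fderiv ℝ Ψ x).det ≠ 0) ∧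
      Ψ '' Set.pi Set.univ (fun _ : Fin n => Set.Ioo (0:ℝ) 1) ⊆ B ∧
      ∀ j, ∃ U : Set (Fin n → ℝ), IsOpen U ∧
        Set.pi Set.univ (fun _ : Fin n => Set.Icc (0:ℝ) 1) ⊆ U ∧
        ∃ (a b : Fin n → ℕ) (e : (Fin n → ℝ) → ℝ), AnalyticOnNhd ℝ e U ∧ (∀ x ∈ U, e x ≠ 0) ∧
          ∀ x ∈ U, G j (Ψ x) = (∏ i, x i ^ a i * (1 - x i) ^ b i) * e x)
    (fun Ψ => Ψ '' Set.pi Set.univ (fun _ : Fin n => Set.Ioo (0:ℝ) 1)) B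
    (fun (q : (ι × (Fin n → Bool)) × Fin M) (x : Fin n → ℝ) => Φ q.1.1
      (fun i => if q.1.2 i then 1 - (∏ j, x j ^ A q.2 i j) / 2 else (∏ j, x j ^ A q.2 i j) / 2))
    (fun q => ⟨h2f q, h2B q, hmono q⟩) h2d h2n
  exact ⟨N, Ψ, fun k => (hP k).1, fun k => (hP k).2.1, hdisj, hnull, fun k j => (hP k).2.2 j⟩

end Literature.NumberTheory.Transcendental
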